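import Summits.CriticalPhenomena.PercolationContinuityZ3.Theorems.PercNearOneGluingNoHeavyLowerTailFrontierDecRowsClusterBHK3ThreeTerm
import HarnessLib

/-!
# A LINEAR quantitative BHK bound: the two-cluster deficit is at most `μ(D)·Cov(U, A)`

Support file (prover prim-ineq-prove-3 gen 11; `--supports stmt-CriticalPhenomena-4575`).  No sorries, no named facts, no definitions.

With `D = {S ↮ T}`, `U = Dᶜ`, `A` cluster-monotone for `C_S`, `B` for `C_T`, and the BHK deficit `Δ* = μ(D∩A)μ(D∩B) − μ(D)μ(D∩A∩B) ≥ 0`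
(`bhk_deficit_nonneg`), Conjecture G⁺ is `Δ* ≤ Cov(U,A)·Cov(U,B) + μ(D)·Cov(1_D,1_{Aᶜ∩Bᶜ})` (`…ClusterBHK3ThreeTerm`).  This file records the much weaker
but UNCONDITIONAL linear bound
  `Δ* ≤ μ(D)·Cov(U, A)`   (and symmetrically `≤ μ(D)·Cov(U, B)`),
i.e. `P(A|D)P(B|D) − P(A∩B|D) ≤ P(U)·[P(A|U) − P(A|D)]`: two Harris inequalities (`A` vs the up-set `U ∪ B`, and `A` vs `D`).  Numerically the ratio
`Δ*/(μ(D)·min(Cov(U,A),Cov(U,B)))` reaches `0.999` (seat probe lab/w3_probe.py, 828 exact cases), so the constant is sharp.  Exact form of the slack: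
`μ(D)·Cov(U,A) − Δ* = μ(D)·Cov(1_A, 1_{U∪B}) + μ(D∩B)·Cov(U,A)`.
-/

noncomputable section

namespace Summit.CriticalPhenomena.PercolationContinuityZ3.Theorems.FrontierDecRows

open MeasureTheory
open Literature.Probability.Percolation Literature.Probability.LatticeModels

variable {V : Type*} [Fintype V]
variable (w : Sym2 V → unitInterval) (S T : Set V) {A B : Set (BondConfig V)}
  (hA : ∀ ⦃ω ω' : BondConfig V⦄, (⋃ s ∈ S, openEdgeCluster ω s) ⊆ (⋃ s ∈ S, openEdgeCluster ω' s) → ω ∈ A → ω' ∈ A)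
  (hB : ∀ ⦃ω ω' : BondConfig V⦄, (⋃ t ∈ T, openEdgeCluster ω t) ⊆ (⋃ t ∈ T, openEdgeCluster ω' t) → ω ∈ B → ω' ∈ B)

include hA hB

/-- **Linear quantitative BHK bound**: `μ(D∩A)μ(D∩B) − μ(D)μ(D∩A∩B) ≤ μ(D)·[μ(Dᶜ∩A) − μ(Dᶜ)μ(A)]` for `A` cluster-monotone in `C_S` and `B` in `C_T`
(Harris for `A` and the up-set `Dᶜ ∪ B`, plus Harris for `A` and `D`). [this work] -/
theorem bhk_deficit_le_mul_cov :
    (prodBernoulli w).real ({ω : BondConfig V | ∀ s ∈ S, ∀ t ∈ T, ¬ (openGraph ω).Reachable s t} ∩ A) *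
          (prodBernoulli w).real ({ω : BondConfig V | ∀ s ∈ S, ∀ t ∈ T, ¬ (openGraph ω).Reachable s t} ∩ B) -
        (prodBernoulli w).real {ω : BondConfig V | ∀ s ∈ S, ∀ t ∈ T, ¬ (openGraph ω).Reachable s t} *
          (prodBernoulli w).real ({ω : BondConfig V | ∀ s ∈ S, ∀ t ∈ T, ¬ (openGraph ω).Reachable s t} ∩ A ∩ B) ≤
      (prodBernoulli w).real {ω : BondConfig V | ∀ s ∈ S, ∀ t ∈ T, ¬ (openGraph ω).Reachable s t} *
        ((prodBernoulli w).real ({ω : BondConfig V | ∀ s ∈ S, ∀ t ∈ T, ¬ (openGraph ω).Reachable s t}ᶜ ∩ A) -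
          (prodBernoulli w).real {ω : BondConfig V | ∀ s ∈ S, ∀ t ∈ T, ¬ (openGraph ω).Reachable s t}ᶜ * (prodBernoulli w).real A) := by
  set μ := prodBernoulli w with hμ
  set D := {ω : BondConfig V | ∀ s ∈ S, ∀ t ∈ T, ¬ (openGraph ω).Reachable s t} with hD
  have hAu : IsUpperSet A := isUpperSet_of_clusterMono S hA
  have hBu : IsUpperSet B := isUpperSet_of_clusterMono T hB
  have hDl : IsLowerSet D := ClusterMarkovE3.isLowerSet_sepEv S T
  have hDm : MeasurableSet D := MeasurableSet.of_discrete
  have hBm : MeasurableSet B := MeasurableSet.of_discrete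
  -- Harris for `A` and the up-set `Dᶜ ∪ B`
  have hUp : IsUpperSet (Dᶜ ∪ B) := hDl.compl.union hBu
  have h1 : μ.real A * μ.real (Dᶜ ∪ B) ≤ μ.real (A ∩ (Dᶜ ∪ B)) :=
    prodBernoulli_harris w hAu hUp MeasurableSet.of_discrete MeasurableSet.of_discrete
  -- Harris for `A` (up) and `D` (down)
  have h2 : μ.real (A ∩ D) ≤ μ.real A * μ.real D :=
    prodBernoulli_harris_upper_lower w hAu hDl MeasurableSet.of_discrete hDm
  -- measure bookkeeping
  have e1 : μ.real (A ∩ (Dᶜ ∪ B)) = μ.real (Dᶜ ∩ A) + μ.real (D ∩ A ∩ B) := by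
    have hdisj : Disjoint (Dᶜ ∩ A) (D ∩ A ∩ B) := by
      rw [Set.disjoint_left]; rintro ω ⟨hω, -⟩ ⟨⟨hω', -⟩, -⟩; exact hω hω'
    have hun : A ∩ (Dᶜ ∪ B) = (Dᶜ ∩ A) ∪ (D ∩ A ∩ B) := by
      ext ω; simp only [Set.mem_inter_iff, Set.mem_union, Set.mem_compl_iff]; tauto
    rw [hun, measureReal_union hdisj MeasurableSet.of_discrete]
  have e2 : μ.real (Dᶜ ∪ B) = μ.real Dᶜ + μ.real (D ∩ B) := by
    have hdisj : Disjoint Dᶜ (D ∩ B) := by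
      rw [Set.disjoint_left]; rintro ω hω ⟨hω', -⟩; exact hω hω'
    have hun : Dᶜ ∪ B = Dᶜ ∪ (D ∩ B) := by
      ext ω; simp only [Set.mem_union, Set.mem_compl_iff, Set.mem_inter_iff]; tauto
    rw [hun, measureReal_union hdisj MeasurableSet.of_discrete]
  have e3 : μ.real Dᶜ = 1 - μ.real D := probReal_compl_eq_one_sub hDm
  rw [Set.inter_comm A D] at h2
  rw [e1, e2, e3] at h1
  have hm0 : 0 ≤ μ.real D := measureReal_nonneg
  have hDB0 : 0 ≤ μ.real (D ∩ B) := measureReal_nonneg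
  have hDA : μ.real (D ∩ A) ≤ μ.real D * μ.real A := by linarith
  -- goal: μ(DA) μ(DB) − m μ(DAB) ≤ m (μ(DᶜA) − (1−m) α)
  rw [e3]
  nlinarith [mul_le_mul_of_nonneg_right hDA hDB0, mul_le_mul_of_nonneg_left h1 hm0, hm0, hDB0]
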